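import Summits.CriticalPhenomena.PercolationContinuityZ3.Theorems.Transplant.AutCocompactFinitelyGenerated
import HarnessLib

/-!
# The Conjecture-1-shaped DICHOTOMY for every cocompact action of a finitely generated virtually nilpotent group: `p_c < 1` exactly unless
# some element acts with finite index modulo the kernel — and then `θ_x(p_c) = 0`

builds on p205010 (kernel theorem, internal audit signed; external expert review pending).  Lane `prim-bschramm`, seat `prim-bschramm-stmt`
gen 38 (stmt port pen; lead g25 GO #7745, part (G) of F3, 'in its own file — one file per name').  Helper file
(`--supports stmt-CriticalPhenomena-4575 --as helper`); PROOFS ONLY (def-free, no `instance`, no notation); NOT by-name — no `@[conjecture]` node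
is touched or settled, STATEMENTS §5 counts unchanged; nothing about growth, nothing about `BenjaminiSchramm1996_conj4_endState`; the virtually
nilpotent group is GIVEN (general quasi-transitive graphs of polynomial growth stay modulo `Trofimov1985_polynomialGrowthBlocks`); no 'closed' wording.

THE THEOREM (`criticalProb_lt_one_iff_of_fg_virtuallyNilpotent`).  `A` finitely generated with a finite-index nilpotent subgroup `N`, acting by
automorphisms with finitely many orbits on a connected locally finite graph `X` — kernel, torsion, stabilisers ARBITRARY.  Then at every vertex
`p_c(X, x) < 1 ⟺ ¬ ∃ a : A, (zpowers a ⊔ ker (A → Perm W))` has finite index in `A` — i.e. `p_c = 1` exactly when ONE element of `A` acts with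
finite index modulo the kernel of the action (the graph is then finite or a line up to finite fibres).  PROOF: p4 gen 22's quasi-transitive dichotomy
`VirtNilpotentAutQT.criticalProb_lt_one_iff_not_virtuallyCyclic` (finite stabilisers of the representatives required) applied LITERALLY to the IMAGE
group `A₀ = (MulAction.toPermHom A W).range` with its finite-index nilpotent subgroup `N.map _` — the stabilisers of `A₀` are finite by
«AutCocompactFinitelyGenerated» §2 (`finite_stabilizer_range`: Schreier + Baer through the tree's Literature) — and the index bookkeeping
`[A₀ : ⟨e a⟩] = [A : ⟨a⟩ ⊔ ker e]` (`MonoidHom.map_zpowers`, `Subgroup.index_map`, `MonoidHom.ker_rangeRestrict`) along the surjection `e : A ↠ A₀`.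
COROLLARY (`conj4_of_fg_virtuallyNilpotent_cocompact_of_not_cyclicModKer`): Conjectures 1 + 4 for the class — if no element acts with finite index
modulo the kernel then `p_c(x) < 1` AND `θ_x(p_c) = 0` at every vertex (the second half is F3's `conj4_of_fg_virtuallyNilpotent_cocompact`).
[cite: BenjaminiSchramm1996, §2 Conj. 1, Conj. 4 (almost transitive graphs)] [cite: LyonsPeres2016, §7.4 Cor. 7.19; §7.9]
[cite: ClementMajewiczZyman2017, Thms 2.18, 2.25, 2.26 (inside `finite_stabilizer_range`)]
-/

noncomputable section

namespace Summit.CriticalPhenomena.PercolationContinuityZ3.Theorems.Transplant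

namespace AutCyl

open SimpleGraph Literature.Barriers.CriticalPhenomena Literature.Probability.LatticeModels Literature.Probability.Percolation
open scoped Classical

variable {W : Type} {X : SimpleGraph W} {A : Type} [Group A] [MulAction A W] [X.LocallyFinite]

/-- Index bookkeeping along `e := rangeRestrict (toPermHom A W) : A ↠ A₀`: the cyclic subgroup generated by the image of `a` has the index of
`zpowers a ⊔ ker` in `A`. [folklore] -/
theorem index_zpowers_rangeRestrict (a : A) :
    (Subgroup.zpowers ((MulAction.toPermHom A W).rangeRestrict a)).index =
      (Subgroup.zpowers a ⊔ (MulAction.toPermHom A W).ker).index := by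
  rw [← MonoidHom.map_zpowers, Subgroup.index_map,
    MonoidHom.range_eq_top_of_surjective _ (MulAction.toPermHom A W).rangeRestrict_surjective, Subgroup.index_top, mul_one,
    MonoidHom.ker_rangeRestrict]

/-- **THE DICHOTOMY (Conjecture 1 form) FOR EVERY COCOMPACT ACTION OF A FINITELY GENERATED VIRTUALLY NILPOTENT GROUP.**  `A` finitely generated with
a finite-index nilpotent subgroup, acting by automorphisms with finitely many orbits on a connected locally finite graph (kernel, torsion, stabilisers
arbitrary): `p_c(X, x) < 1 ⟺` no element of `A` generates, together with the kernel of the action, a finite-index subgroup.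
[cite: BenjaminiSchramm1996, §2 Conj. 1 (almost transitive graphs)] [cite: LyonsPeres2016, §7.4 Cor. 7.19; §7.9] -/
theorem criticalProb_lt_one_iff_of_fg_virtuallyNilpotent [Group.FG A] (hc : X.Connected) (hact : IsActionByAut X A) (reps : Finset W)
    (hcover : ∀ w : W, ∃ a : A, ∃ r ∈ reps, a • r = w) (N : Subgroup A) [N.FiniteIndex] [Group.IsNilpotent N] (x : W) :
    criticalProb X x < 1 ↔ ¬ ∃ a : A, (Subgroup.zpowers a ⊔ (MulAction.toPermHom A W).ker).FiniteIndex := by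
  have he : Function.Surjective (MulAction.toPermHom A W).rangeRestrict := (MulAction.toPermHom A W).rangeRestrict_surjective
  haveI : (N.map (MulAction.toPermHom A W).rangeRestrict).FiniteIndex := ⟨fun h0 =>
    Subgroup.FiniteIndex.index_ne_zero (Nat.eq_zero_of_zero_dvd (h0 ▸ Subgroup.index_map_dvd (H := N) he))⟩
  haveI : Group.IsNilpotent (N.map (MulAction.toPermHom A W).rangeRestrict) :=
    Group.nilpotent_of_surjective ((MulAction.toPermHom A W).rangeRestrict.subgroupMap N)
      ((MulAction.toPermHom A W).rangeRestrict.subgroupMap_surjective N)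
  rw [VirtNilpotentAutQT.criticalProb_lt_one_iff_not_virtuallyCyclic (isActionByAut_range hact) hc reps (cover_range hcover)
    (fun r _ => finite_stabilizer_range N hc hact reps hcover r) (N.map (MulAction.toPermHom A W).rangeRestrict) x, not_iff_not]
  constructor
  · rintro ⟨c, hcfi⟩
    obtain ⟨a, rfl⟩ := he c
    exact ⟨a, ⟨by rw [← index_zpowers_rangeRestrict]; exact hcfi.index_ne_zero⟩⟩
  · rintro ⟨a, ha⟩
    exact ⟨(MulAction.toPermHom A W).rangeRestrict a, ⟨by rw [index_zpowers_rangeRestrict]; exact ha.index_ne_zero⟩⟩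

/-- **CONJECTURES 1 AND 4 for every cocompact action of a finitely generated virtually nilpotent group**: if no element acts with finite index modulo the
kernel, then `p_c(x) < 1` AND `θ_x(p_c) = 0` at every vertex. [cite: BenjaminiSchramm1996, §2 Conj. 1, Conj. 4 (almost transitive graphs)] -/
theorem conj4_of_fg_virtuallyNilpotent_cocompact_of_not_cyclicModKer [Group.FG A] (hc : X.Connected) (hact : IsActionByAut X A)
    (reps : Finset W) (hcover : ∀ w : W, ∃ a : A, ∃ r ∈ reps, a • r = w) (N : Subgroup A) [N.FiniteIndex] [Group.IsNilpotent N]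
    (hncyc : ¬ ∃ a : A, (Subgroup.zpowers a ⊔ (MulAction.toPermHom A W).ker).FiniteIndex) (x : W) :
    criticalProb X x < 1 ∧ theta X x (criticalProbIOf X x) = 0 :=
  have hpc := (criticalProb_lt_one_iff_of_fg_virtuallyNilpotent hc hact reps hcover N x).2 hncyc
  ⟨hpc, conj4_of_fg_virtuallyNilpotent_cocompact hc hact reps hcover N x hpc⟩

end AutCyl

end Summit.CriticalPhenomena.PercolationContinuityZ3.Theorems.Transplant

end
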